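import Mathlib
import Summits.NavierStokesRegularity.NavierStokesRegularity.Theses.EulerZoomLiouville
import Summits.NavierStokesRegularity.NavierStokesRegularity.Theorems.EulerZoomLiouvilleSereginZoomReductionZoomTools
import Summits.NavierStokesRegularity.NavierStokesRegularity.Theorems.EulerZoomLiouvilleSereginZoomReductionRepresentative
import Summits.NavierStokesRegularity.NavierStokesRegularity.Theorems.EulerZoomLiouvilleSereginZoomReductionSlabCompactness
import Summits.NavierStokesRegularity.NavierStokesRegularity.Theorems.EulerZoomLiouvilleSereginZoomReductionEulerZoom
import Summits.NavierStokesRegularity.NavierStokesRegularity.Theorems.EulerZoomLiouvilleSereginZoomReductionPressureLsc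
import Literature.Analysis.FluidPDE.LocalTypeILscVelocity
import Literature.Analysis.FluidPDE.LocalTypeILscGradient
import Literature.Analysis.FluidPDE.Seregin2020CubicLowerBound
import Literature.Analysis.FluidPDE.NSSuitableESSProofs
import HarnessLib

/-!
# `SereginZoomReduction` PROVED: Seregin's Euler-zoom theorem at the power weight, in the kernel
# (route №10 `EulerZoomLiouville`, support item Z = stmt-NavierStokesRegularity-19834)

The support item `EulerZoomLiouville.SereginZoomReduction` of route №10 — G. Seregin, *On potential Type II blowups for
the Navier–Stokes equations*, arXiv:2606.29468, Thm 3.1 at `(s,l,κ,η) = (3,3,2,0)`, `f(r) = r^ρ` (= arXiv:2304.04045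
Prop 1.2 with `m = 1 − ρ`): a suitable weak Navier–Stokes solution in a parabolic ball with the power-gauged bound
(1.7) and the floor (3.1) has an Euler zoom limit which is a NON-TRIVIAL member of the class of the crux
`PowerGaugeEulerLiouville` — so far carried CONDITIONALLY on the typed printed theorem
(`sereginZoomReduction_of_eulerLimit`).  This file proves it outright, for EVERY `ρ > 0` (the item asks
`0 < ρ ≤ 1/2`; the growth condition (3.3), `ρ ≤ 17/20`, is needed in print only for general `(s,l,η)` — at
`(3,3)` strong `L³` convergence is inside the `L^{10/3}` interpolation range):

normalise to the unit cylinder (`…ZoomTools`); pick floor radii `r_k ≤ 2^{−k}`; the Euler zooms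
`v_k = r_k^{1+ρ} v(r_k^{2+ρ}s, r_k y)` solve Navier–Stokes with viscosity `r_k^ρ → 0` on `Q(0,2ᵐ)`, `m ≤ k`, with
uniform bounds (`…EulerZoom`); vanishing-viscosity compactness on the growing cylinders gives ONE suitable weak EULER
solution `(u,p)` on the slab with strong `L³` / weak `L^{3/2}` convergence on every `Q(0,2ᵐ)` (`…SlabCompactness`, on
`…CylinderCompactness`, `…VelocityCompactness`, `…VanishingViscosityStability`, `…PairingModulus`); the three gauges
pass to the limit at every radius by lower semicontinuity (`cknAEss_le_of_tendsto_eLpNorm`,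
`cknE_le_of_tendsto_eLpNorm`, `setLIntegral_threeHalves_le_of_tendsto_weakly`); the genuine-supremum representative
(`exists_sup_representative`) and the persistence of the floor `∫_{Q(1)} |v_k|³ ≥ ε₀` under strong `L³` convergence
(`le_cknC_of_tendsto_eLpNorm`) finish.

* `sereginZoomReduction_proof : Theses.EulerZoomLiouville.SereginZoomReduction`.

WHAT THIS IS NOT: not NS regularity and not the crux `PowerGaugeEulerLiouville` (open: the Chae–Shvydkoy window) —
it closes the support item Z, so that the route's reduction of `NavierStokesRegularity` rests on the named crux E and
the two declared residuals only. [cite: Seregin2026, Thm 3.1 (p. 9)]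
-/

noncomputable section

set_option linter.dupNamespace false

open MeasureTheory TopologicalSpace Set Function Filter Topology Metric
open scoped NNReal ENNReal InnerProductSpace RealInnerProductSpace

namespace Summit.NavierStokesRegularity.NavierStokesRegularity.Theorems.SereginZoomReduction

open Literature.Analysis Literature.Analysis.FluidPDE Literature.Analysis.FunctionSpaces
  Literature.Analysis.FluidPDE.Seregin2023

/-- **`SereginZoomReduction` holds** (item Z of route `EulerZoomLiouville`, stmt-NavierStokesRegularity-19834):
Seregin's Euler-zoom theorem at the power weight, proved by vanishing-viscosity compactness (see the file
docstring). [cite: Seregin2026, Thm 3.1 (p. 9)] -/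
theorem sereginZoomReduction_proof :
    Summit.NavierStokesRegularity.NavierStokesRegularity.Theses.EulerZoomLiouville.SereginZoomReduction := by
  intro ρ hρ _hρhalf r₀ z₀ v q G hr₀ hsw hG hM hfloor
  have hρhalf : ρ ≤ 1 / 2 := _hρhalf
  obtain ⟨M, hM⟩ := hM
  obtain ⟨ε₀, hε₀, hfloor⟩ := hfloor
  ------------------------------------------------------------------
  -- (0) normalisation to the unit cylinder `Q(0,1)` (Navier–Stokes zoom, λ₀ = min(r₀,1))
  ------------------------------------------------------------------
  set lam : ℝ := min r₀ 1 with hlamdef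
  have hlam : 0 < lam := lt_min hr₀ one_pos
  have hlam1 : lam ≤ 1 := min_le_right _ _
  have hlamr : lam ≤ r₀ := min_le_left _ _
  set U : ℝ → EuclideanSpace ℝ (Fin 3) → EuclideanSpace ℝ (Fin 3) :=
    lam • stPull (lam ^ 2) lam z₀.1 z₀.2 v with hUdef
  set P : ℝ → EuclideanSpace ℝ (Fin 3) → ℝ := lam ^ 2 • stPull (lam ^ 2) lam z₀.1 z₀.2 q with hPdef
  set G' : ℝ → EuclideanSpace ℝ (Fin 3) → EuclideanSpace ℝ (Fin 3) →L[ℝ] EuclideanSpace ℝ (Fin 3) :=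
    (lam * lam) • stPull (lam ^ 2) lam z₀.1 z₀.2 G with hG'def
  have hU : IsSuitableWeakSolutionInBall 1 (0 : ℝ × EuclideanSpace ℝ (Fin 3)) U P :=
    (isSuitableWeakSolutionInBall_mono_radius hsw hlam hlamr).zoom hlam
  have hle : parabolicCylinderOpens lam z₀ ≤ parabolicCylinderOpens r₀ z₀ := by
    intro z hz
    have hz' : z ∈ parabolicCylinder lam z₀ := hz
    show z ∈ parabolicCylinder r₀ z₀
    unfold parabolicCylinder at hz' ⊢
    refine prod_mono (Ioo_subset_Ioo ?_ le_rfl) (ball_subset_ball hlamr) hz'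
    have : lam ^ 2 ≤ r₀ ^ 2 := pow_le_pow_left₀ hlam.le hlamr 2
    linarith
  have hG' : HasWeakSpatialGradientOn (parabolicCylinderOpens 1 (0 : ℝ × EuclideanSpace ℝ (Fin 3))) U G' := by
    have h1 := (hG.mono hle).stRescale lam (pow_pos hlam 2) hlam z₀.1 z₀.2
    rwa [zoom_stPreimage_parabolicCylinderOpens hlam z₀] at h1
  set M' : ℝ≥0 := (lam ^ (-(2 * ρ))).toNNReal * M with hM'def
  have hM'coe : (M' : ℝ≥0∞) = ENNReal.ofReal (lam ^ (-(2 * ρ))) * (M : ℝ≥0∞) := by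
    rw [hM'def, ENNReal.coe_mul]; rfl
  have hgauge : ∀ r ∈ Ioc (0 : ℝ) 1,
      ENNReal.ofReal (r ^ (2 * ρ)) * cknA r (0 : ℝ × EuclideanSpace ℝ (Fin 3)) U +
          ENNReal.ofReal (r ^ ρ) * cknE r (0 : ℝ × EuclideanSpace ℝ (Fin 3)) G' +
          ENNReal.ofReal (r ^ (2 * ρ)) * cknD r (0 : ℝ × EuclideanSpace ℝ (Fin 3)) P ≤ (M' : ℝ≥0∞) := by
    intro r hr
    rw [hM'coe]
    exact gauge_zoom_le hρ.le hlam hlam1 hlamr hM r hr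
  have hfloorU := floor_zoom hρ.le hlam hlam1 z₀ v hfloor
  have hswU : IsSuitableWeakSolutionOn (parabolicCylinderOpens 1 (0 : ℝ × EuclideanSpace ℝ (Fin 3))) 1 0 U P :=
    hU.1
  ------------------------------------------------------------------
  -- (1) the floor radii `r_k < 2^{-k}` and the Euler zooms
  ------------------------------------------------------------------
  have hδ : ∀ k : ℕ, (0 : ℝ) < ((2 : ℝ) ^ k)⁻¹ := fun k => by positivity
  choose r hr hfl using fun k : ℕ => hfloorU (((2 : ℝ) ^ k)⁻¹) (hδ k)
  have hr0 : ∀ k, 0 < r k := fun k => (hr k).1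
  have hr1 : ∀ k, r k ≤ 1 := fun k => by
    have h := (hr k).2.le
    exact h.trans (inv_le_one_of_one_le₀ (one_le_pow₀ (by norm_num)))
  have hrm : ∀ m k : ℕ, m ≤ k → r k * (2 : ℝ) ^ m ≤ 1 := by
    intro m k hmk
    have h1 : (2 : ℝ) ^ m ≤ (2 : ℝ) ^ k := pow_le_pow_right₀ (by norm_num) hmk
    have h2k : (0 : ℝ) < (2 : ℝ) ^ k := by positivity
    have h2 : r k * (2 : ℝ) ^ k ≤ 1 :=
      calc r k * (2 : ℝ) ^ k ≤ ((2 : ℝ) ^ k)⁻¹ * (2 : ℝ) ^ k :=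
            mul_le_mul_of_nonneg_right (hr k).2.le h2k.le
        _ = 1 := inv_mul_cancel₀ h2k.ne'
    exact (mul_le_mul_of_nonneg_left h1 (hr0 k).le).trans h2
  set V : ℕ → ℝ → EuclideanSpace ℝ (Fin 3) → EuclideanSpace ℝ (Fin 3) :=
    fun k => ((r k) ^ (1 + ρ)) • stPull ((r k) ^ (2 + ρ)) (r k) 0 (0 : EuclideanSpace ℝ (Fin 3)) U with hVdef
  set Pz : ℕ → ℝ → EuclideanSpace ℝ (Fin 3) → ℝ :=
    fun k => ((r k) ^ (1 + ρ)) ^ 2 • stPull ((r k) ^ (2 + ρ)) (r k) 0 (0 : EuclideanSpace ℝ (Fin 3)) P with hPzdef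
  set GV : ℕ → ℝ → EuclideanSpace ℝ (Fin 3) → EuclideanSpace ℝ (Fin 3) →L[ℝ] EuclideanSpace ℝ (Fin 3) :=
    fun k => ((r k) ^ (1 + ρ) * r k) • stPull ((r k) ^ (2 + ρ)) (r k) 0 (0 : EuclideanSpace ℝ (Fin 3)) G'
    with hGVdef
  set ν : ℕ → ℝ := fun k => (r k) ^ ρ with hνdef
  have hν0 : ∀ k, 0 ≤ ν k := fun k => Real.rpow_nonneg (hr0 k).le _
  have hν1 : ∀ k, ν k ≤ 1 := fun k => Real.rpow_le_one (hr0 k).le (hr1 k) hρ.le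
  have hrlim : Tendsto r atTop (𝓝 0) := by
    refine squeeze_zero (fun k => (hr0 k).le) (fun k => (hr k).2.le) ?_
    have h := tendsto_pow_atTop_nhds_zero_of_lt_one (r := (1 / 2 : ℝ)) (by norm_num) (by norm_num)
    refine h.congr fun k => ?_
    rw [one_div, inv_pow]
  have hνlim : Tendsto ν atTop (𝓝 0) := by
    have h := hrlim.rpow_const (p := ρ) (Or.inr hρ.le)
    rwa [Real.zero_rpow hρ.ne'] at h
  ------------------------------------------------------------------
  -- (2) level hypotheses on `Q(0, 2ᵐ)`, `m ≤ k`
  ------------------------------------------------------------------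
  have h2pos : ∀ m : ℕ, (0 : ℝ) < (2 : ℝ) ^ m := fun m => by positivity
  have h2one : ∀ m : ℕ, (1 : ℝ) ≤ (2 : ℝ) ^ m := fun m => one_le_pow₀ (by norm_num)
  set C : ℕ → ℝ≥0 := fun m => M' * (((2 : ℝ) ^ m) ^ (1 - ρ)).toNNReal with hCdef
  have hCcoe : ∀ m, (C m : ℝ≥0∞) = ENNReal.ofReal (((2 : ℝ) ^ m) ^ (1 - ρ)) * M' := fun m => by
    rw [hCdef, ENNReal.coe_mul, mul_comm]; rfl
  set Mp : ℕ → ℝ≥0∞ := fun m => ENNReal.ofReal (((2 : ℝ) ^ m) ^ (2 - 2 * ρ)) * M' with hMpdef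
  have hMp : ∀ m, Mp m ≠ ∞ := fun m => ENNReal.mul_ne_top ENNReal.ofReal_ne_top ENNReal.coe_ne_top
  have hswk : ∀ m k : ℕ, m ≤ k → IsSuitableWeakSolutionOn
      (parabolicCylinderOpens ((2 : ℝ) ^ m) (0 : ℝ × EuclideanSpace ℝ (Fin 3))) (ν k) 0 (V k) (Pz k) :=
    fun m k hmk => eulerZoom_isSuitableWeakSolutionOn hρ.le (hr0 k) (hr1 k) (h2pos m) (hrm m k hmk) hswU
  have hGk : ∀ m k : ℕ, m ≤ k → HasWeakSpatialGradientOn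
      (parabolicCylinderOpens ((2 : ℝ) ^ m) (0 : ℝ × EuclideanSpace ℝ (Fin 3))) (V k) (GV k) :=
    fun m k hmk => eulerZoom_hasWeakSpatialGradientOn hρ.le (hr0 k) (hr1 k) (h2pos m) (hrm m k hmk) hG'
  have hEk : ∀ m k : ℕ, m ≤ k → ∀ᵐ t ∂(volume.restrict (Ioo (-((2 : ℝ) ^ m) ^ 2) 0)),
      ∫⁻ x in ball (0 : EuclideanSpace ℝ (Fin 3)) ((2 : ℝ) ^ m), ‖V k t x‖ₑ ^ 2 ≤ C m := by
    intro m k hmk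
    filter_upwards [ae_restrict_mem measurableSet_Ioo] with t ht
    refine (eulerZoom_slice_energy_le hρ.le (hr0 k) (hr1 k) (h2pos m) (hrm m k hmk) hgauge ht).trans ?_
    rw [hCcoe]
    exact mul_le_mul' (ENNReal.ofReal_le_ofReal
      (Real.rpow_le_rpow_of_exponent_le (h2one m) (by linarith))) le_rfl
  have hGbk : ∀ m k : ℕ, m ≤ k → ∫⁻ z in parabolicCylinder ((2 : ℝ) ^ m) (0 : ℝ × EuclideanSpace ℝ (Fin 3)),
      ENNReal.ofReal (frobeniusNormSq (GV k z.1 z.2)) ≤ C m := fun m k hmk => by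
    rw [hCcoe]; exact eulerZoom_grad_le hρ.le (hr0 k) (hr1 k) (h2pos m) (hrm m k hmk) hgauge
  have hPbk : ∀ m k : ℕ, m ≤ k → ∫⁻ z in parabolicCylinder ((2 : ℝ) ^ m) (0 : ℝ × EuclideanSpace ℝ (Fin 3)),
      ‖Pz k z.1 z.2‖ₑ ^ (3 / 2 : ℝ) ≤ Mp m := fun m k hmk =>
    eulerZoom_pressure_le hρ.le (hr0 k) (hr1 k) (h2pos m) (hrm m k hmk) hgauge
  ------------------------------------------------------------------
  -- (3) the Euler limit on the slab
  ------------------------------------------------------------------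
  obtain ⟨σ, u, p, hσ, hslab, hlev⟩ :=
    slab_compactness_vanishingViscosity hν0 hν1 hνlim hMp hswk hGk hEk hGbk hPbk
  obtain ⟨H, hH, -, -⟩ := hslab.localEnergy
  have hσm : ∀ m j : ℕ, m ≤ σ (j + m) := fun m j => (Nat.le_add_left m j).trans (hσ.id_le (j + m))
  ------------------------------------------------------------------
  -- (4) the three gauges of the limit at every radius `a > 0`
  ------------------------------------------------------------------
  have hgaugeLim : ∀ a : ℝ, 0 < a →
      weightedA (fun r => r ^ ρ) a (0 : ℝ × EuclideanSpace ℝ (Fin 3)) u ≤ (M' : ℝ≥0∞) ∧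
      ENNReal.ofReal (a ^ ρ) * cknE a (0 : ℝ × EuclideanSpace ℝ (Fin 3)) H ≤ (M' : ℝ≥0∞) ∧
      ENNReal.ofReal (a ^ (2 * ρ)) * cknD a (0 : ℝ × EuclideanSpace ℝ (Fin 3)) p ≤ (M' : ℝ≥0∞) := by
    intro a ha
    obtain ⟨m, hm⟩ := pow_unbounded_of_one_lt a (by norm_num : (1 : ℝ) < 2)
    set Q₀ : Set (ℝ × EuclideanSpace ℝ (Fin 3)) :=
      parabolicCylinder ((2 : ℝ) ^ m) (0 : ℝ × EuclideanSpace ℝ (Fin 3)) with hQ₀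
    have hQ : parabolicCylinder a (0 : ℝ × EuclideanSpace ℝ (Fin 3)) ⊆ Q₀ :=
      SuitableCompactness.parabolicCylinder_zero_mono ha.le hm.le
    have hQle : parabolicCylinderOpens a (0 : ℝ × EuclideanSpace ℝ (Fin 3)) ≤
        parabolicCylinderOpens ((2 : ℝ) ^ m) (0 : ℝ × EuclideanSpace ℝ (Fin 3)) := fun z hz => hQ hz
    obtain ⟨-, hu3, -, ⟨Gu, hGu, hGub⟩, hpm, hpb, hL3, hweak⟩ := hlev m
    -- the tail `k ↦ σ (k + m)` and the radii `λ_k = r (σ (k+m))`, `λ_k a ≤ 1`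
    have hla : ∀ k, r (σ (k + m)) * a ≤ 1 := fun k =>
      le_trans (mul_le_mul_of_nonneg_left hm.le (hr0 _).le) (hrm m _ (hσm m k))
    have hvm : ∀ k, AEStronglyMeasurable (uncurry (V (σ (k + m)))) (volume.restrict Q₀) := fun k =>
      (hswk m _ (hσm m k)).distributional.1.aestronglyMeasurable
    have hL3' : Tendsto (fun k => eLpNorm (uncurry (V (σ (k + m))) - uncurry u) 3 (volume.restrict Q₀))
        atTop (𝓝 0) := hL3.comp (tendsto_add_atTop_nat m)
    -- real-exponent bookkeeping
    have hofa : ∀ e : ℝ, ENNReal.ofReal (a ^ e) ≠ 0 := fun e => (ENNReal.ofReal_pos.2 (Real.rpow_pos_of_pos ha _)).ne'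
    have hmulexp : ∀ e₁ e₂ : ℝ, ENNReal.ofReal (a ^ e₁) * ENNReal.ofReal (a ^ e₂) = ENNReal.ofReal (a ^ (e₁ + e₂)) :=
      fun e₁ e₂ => by rw [← ENNReal.ofReal_mul (Real.rpow_nonneg ha.le _), Real.rpow_add ha]
    have hinva : (ENNReal.ofReal a)⁻¹ = ENNReal.ofReal (a ^ (-1 : ℝ)) := by
      rw [Real.rpow_neg_one, ENNReal.ofReal_inv_of_pos ha]
    have hinva2 : (ENNReal.ofReal a ^ 2)⁻¹ = ENNReal.ofReal (a ^ (-2 : ℝ)) := by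
      rw [← ENNReal.ofReal_pow ha.le, ← ENNReal.ofReal_inv_of_pos (pow_pos ha 2), Real.rpow_neg ha.le,
        Real.rpow_two]
    refine ⟨?_, ?_, ?_⟩
    · -- A: essential supremum of the slice energies
      have hboundA : ∀ k, cknAEss a (0 : ℝ × EuclideanSpace ℝ (Fin 3)) (V (σ (k + m))) ≤
          ENNReal.ofReal (a ^ (-(2 * ρ))) * M' := by
        intro k
        unfold cknAEss
        refine essSup_le_of_ae_le _ ?_
        filter_upwards [ae_restrict_mem measurableSet_Ioo] with t ht
        have ht' : t ∈ Ioo (-a ^ 2) 0 := by simpa using ht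
        have h1 := eulerZoom_slice_energy_le hρ.le (hr0 _) (hr1 _) ha (hla k) hgauge ht'
        calc (ENNReal.ofReal a)⁻¹ * ∫⁻ x in ball (0 : ℝ × EuclideanSpace ℝ (Fin 3)).2 a,
              ‖V (σ (k + m)) t x‖ₑ ^ 2
            ≤ (ENNReal.ofReal a)⁻¹ * (ENNReal.ofReal (a ^ (1 - 2 * ρ)) * M') := mul_le_mul' le_rfl h1
          _ = ENNReal.ofReal (a ^ (-(2 * ρ))) * M' := by
              rw [← mul_assoc, hinva, hmulexp, show (-1 : ℝ) + (1 - 2 * ρ) = -(2 * ρ) by ring]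
      have hAess : cknAEss a (0 : ℝ × EuclideanSpace ℝ (Fin 3)) u ≤ ENNReal.ofReal (a ^ (-(2 * ρ))) * M' :=
        cknAEss_le_of_tendsto_eLpNorm ha hQ hvm (hu3.1) hL3' hboundA
      -- `A_f = a^{2ρ} · A`
      have hwA : weightedA (fun r => r ^ ρ) a (0 : ℝ × EuclideanSpace ℝ (Fin 3)) u =
          ENNReal.ofReal (a ^ (2 * ρ)) * cknAEss a (0 : ℝ × EuclideanSpace ℝ (Fin 3)) u := by
        unfold weightedA cknAEss
        rw [← ENNReal.essSup_const_mul]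
        congr 1
        funext t
        rw [← mul_assoc]
        congr 1
        rw [hinva, hmulexp, show 2 * ρ + (-1 : ℝ) = 2 * ρ - 1 by ring,
          show (a ^ ρ) ^ 2 / a = a ^ (2 * ρ - 1) by
            rw [← Real.rpow_natCast, ← Real.rpow_mul ha.le, Real.rpow_sub ha, Real.rpow_one]; ring_nf]
      rw [hwA]
      calc ENNReal.ofReal (a ^ (2 * ρ)) * cknAEss a (0 : ℝ × EuclideanSpace ℝ (Fin 3)) u
          ≤ ENNReal.ofReal (a ^ (2 * ρ)) * (ENNReal.ofReal (a ^ (-(2 * ρ))) * M') := mul_le_mul' le_rfl hAess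
        _ = M' := by rw [← mul_assoc, hmulexp, show 2 * ρ + -(2 * ρ) = 0 by ring, Real.rpow_zero,
            ENNReal.ofReal_one, one_mul]
    · -- E: the weak gradient, any representative
      have hboundE : ∀ k, cknE a (0 : ℝ × EuclideanSpace ℝ (Fin 3)) (GV (σ (k + m))) ≤
          ENNReal.ofReal (a ^ (-ρ)) * M' := by
        intro k
        unfold cknE
        have h1 := eulerZoom_grad_le hρ.le (hr0 (σ (k + m))) (hr1 _) ha (hla k) hgauge
        calc (ENNReal.ofReal a)⁻¹ * ∫⁻ z in parabolicCylinder a (0 : ℝ × EuclideanSpace ℝ (Fin 3)),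
              ENNReal.ofReal (frobeniusNormSq (GV (σ (k + m)) z.1 z.2))
            ≤ (ENNReal.ofReal a)⁻¹ * (ENNReal.ofReal (a ^ (1 - ρ)) * M') := mul_le_mul' le_rfl h1
          _ = ENNReal.ofReal (a ^ (-ρ)) * M' := by
              rw [← mul_assoc, hinva, hmulexp, show (-1 : ℝ) + (1 - ρ) = -ρ by ring]
      have hGuA : HasWeakSpatialGradientOn (parabolicCylinderOpens a (0 : ℝ × EuclideanSpace ℝ (Fin 3))) u Gu :=
        hGu.mono hQle
      have hGu2 : ∫⁻ w in parabolicCylinder a (0 : ℝ × EuclideanSpace ℝ (Fin 3)),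
          ENNReal.ofReal (frobeniusNormSq (Gu w.1 w.2)) < ∞ :=
        ((lintegral_mono_set hQ).trans hGub).trans_lt ENNReal.coe_lt_top
      have hEGu : cknE a (0 : ℝ × EuclideanSpace ℝ (Fin 3)) Gu ≤ ENNReal.ofReal (a ^ (-ρ)) * M' :=
        cknE_le_of_tendsto_eLpNorm ha hQ
          (fun k => eulerZoom_hasWeakSpatialGradientOn hρ.le (hr0 (σ (k + m))) (hr1 _) ha (hla k) hG')
          hGuA hGu2 hL3' hboundE
      -- `H = Gu` a.e. on `Q(0, 2ᵐ)`
      have hslable : parabolicCylinderOpens ((2 : ℝ) ^ m) (0 : ℝ × EuclideanSpace ℝ (Fin 3)) ≤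
          (slab (EuclideanSpace ℝ (Fin 3)) (Iio 0) isOpen_Iio) := fun z hz =>
        parabolicCylinder_subset_lowerHalf le_rfl _ hz
      have hae := (hH.mono hslable).ae_eq hGu
      have hEH : cknE a (0 : ℝ × EuclideanSpace ℝ (Fin 3)) H = cknE a (0 : ℝ × EuclideanSpace ℝ (Fin 3)) Gu := by
        unfold cknE
        congr 1
        refine lintegral_congr_ae ?_
        filter_upwards [ae_restrict_of_ae_restrict_of_subset hQ hae] with z hz
        have e : H z.1 z.2 = Gu z.1 z.2 := hz
        rw [e]
      rw [hEH]
      calc ENNReal.ofReal (a ^ ρ) * cknE a (0 : ℝ × EuclideanSpace ℝ (Fin 3)) Gu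
          ≤ ENNReal.ofReal (a ^ ρ) * (ENNReal.ofReal (a ^ (-ρ)) * M') := mul_le_mul' le_rfl hEGu
        _ = M' := by rw [← mul_assoc, hmulexp, show ρ + -ρ = 0 by ring, Real.rpow_zero, ENNReal.ofReal_one, one_mul]
    · -- D: weak lower semicontinuity of the pressure mass on `Q(0,a)`
      haveI : IsFiniteMeasure (volume.restrict Q₀) :=
        SuitableCompactness.isFiniteMeasure_restrict_parabolicCylinder_zero _
      have hp32 : MemLp (uncurry p) (3 / 2) (volume.restrict Q₀) :=
        (memLp_threeHalves_of_lintegral_le hpm (hMp m) hpb).1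
      have hq32 : ∀ k, MemLp (uncurry (Pz (σ (k + m)))) (3 / 2) (volume.restrict Q₀) := fun k =>
        (memLp_threeHalves_of_lintegral_le ((hswk m _ (hσm m k)).distributional.2.2.1.aestronglyMeasurable)
          (hMp m) (hPbk m _ (hσm m k))).1
      have hweak' : ∀ g : ℝ × EuclideanSpace ℝ (Fin 3) → ℝ, MemLp g 3 (volume.restrict Q₀) →
          Tendsto (fun k => ∫ w in Q₀, Pz (σ (k + m)) w.1 w.2 * g w) atTop (𝓝 (∫ w in Q₀, p w.1 w.2 * g w)) :=
        fun g hg => (hweak g hg).comp (tendsto_add_atTop_nat m)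
      have hboundD : ∀ k, ∫⁻ w in parabolicCylinder a (0 : ℝ × EuclideanSpace ℝ (Fin 3)),
          ‖Pz (σ (k + m)) w.1 w.2‖ₑ ^ (3 / 2 : ℝ) ≤ ENNReal.ofReal (a ^ (2 - 2 * ρ)) * M' := fun k =>
        eulerZoom_pressure_le hρ.le (hr0 (σ (k + m))) (hr1 _) ha (hla k) hgauge
      have hDp := setLIntegral_threeHalves_le_of_tendsto_weakly
        (isOpen_parabolicCylinder _ _).measurableSet hQ hq32 hp32 hweak' hboundD
      unfold cknD
      calc ENNReal.ofReal (a ^ (2 * ρ)) * ((ENNReal.ofReal a ^ 2)⁻¹ *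
            ∫⁻ w in parabolicCylinder a (0 : ℝ × EuclideanSpace ℝ (Fin 3)), ‖p w.1 w.2‖ₑ ^ (3 / 2 : ℝ))
          ≤ ENNReal.ofReal (a ^ (2 * ρ)) * ((ENNReal.ofReal a ^ 2)⁻¹ * (ENNReal.ofReal (a ^ (2 - 2 * ρ)) * M')) := by
            gcongr
        _ = M' := by
            rw [hinva2, ← mul_assoc, ← mul_assoc, hmulexp, hmulexp,
              show 2 * ρ + (-2 : ℝ) + (2 - 2 * ρ) = 0 by ring, Real.rpow_zero, ENNReal.ofReal_one, one_mul]
  ------------------------------------------------------------------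
  -- (5) the genuine-supremum representative and the assembly
  ------------------------------------------------------------------
  have hA : ∀ a : ℝ, 0 < a → weightedA (fun r => r ^ ρ) a (0 : ℝ × EuclideanSpace ℝ (Fin 3)) u ≤ (M' : ℝ≥0∞) :=
    fun a ha => (hgaugeLim a ha).1
  obtain ⟨N, -, hae, hAsup⟩ := exists_sup_representative hρhalf hA
  have hae' : ∀ᵐ z ∂(volume.restrict ((slab (EuclideanSpace ℝ (Fin 3)) (Iio 0) isOpen_Iio :
      Opens (ℝ × EuclideanSpace ℝ (Fin 3))) : Set (ℝ × EuclideanSpace ℝ (Fin 3)))),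
      uncurry u z = uncurry (Nᶜ.indicator u) z :=
    ae_restrict_of_ae (hae.mono fun z hz => hz.symm)
  refine ⟨Nᶜ.indicator u, p, H, 3 * M', hslab.congr_ae hae' (Eventually.of_forall fun _ => rfl),
    hH.congr_ae hae', fun a ha => ?_, fun hzero => ?_⟩
  · obtain ⟨-, hE, hD⟩ := hgaugeLim a ha
    calc ENNReal.ofReal (a ^ (2 * ρ)) * cknA a (0 : ℝ × EuclideanSpace ℝ (Fin 3)) (Nᶜ.indicator u) +
          ENNReal.ofReal (a ^ ρ) * cknE a (0 : ℝ × EuclideanSpace ℝ (Fin 3)) H +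
          ENNReal.ofReal (a ^ (2 * ρ)) * cknD a (0 : ℝ × EuclideanSpace ℝ (Fin 3)) p
        ≤ (M' : ℝ≥0∞) + M' + M' := add_le_add (add_le_add (hAsup a ha) hE) hD
      _ = ((3 * M' : ℝ≥0) : ℝ≥0∞) := by push_cast; ring
  ------------------------------------------------------------------
  -- (6) non-triviality: the floor persists under strong `L³` convergence on `Q(0,1)`
  ------------------------------------------------------------------
  · obtain ⟨-, hu3, -, -, -, -, hL3, -⟩ := hlev 0
    have hQ1 : parabolicCylinder 1 (0 : ℝ × EuclideanSpace ℝ (Fin 3)) ⊆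
        parabolicCylinder ((2 : ℝ) ^ 0) (0 : ℝ × EuclideanSpace ℝ (Fin 3)) := by rw [pow_zero]
    have hvm : ∀ k, AEStronglyMeasurable (uncurry (V (σ k)))
        (volume.restrict (parabolicCylinder ((2 : ℝ) ^ 0) (0 : ℝ × EuclideanSpace ℝ (Fin 3)))) := fun k =>
      (hswk 0 _ (Nat.zero_le _)).distributional.1.aestronglyMeasurable
    have hboundC : ∀ k, ENNReal.ofReal ε₀ ≤ cknC 1 (0 : ℝ × EuclideanSpace ℝ (Fin 3)) (V (σ k)) := by
      intro k
      unfold cknC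
      rw [ENNReal.ofReal_one, one_pow, inv_one, one_mul, eulerZoom_cube_eq (hr0 _) ρ U]
      have h := hfl (σ k)
      simp only [Prod.fst_zero, Prod.snd_zero, zero_sub] at h
      exact h
    have hC := Seregin2020.le_cknC_of_tendsto_eLpNorm one_pos hQ1 hvm hu3.1 hL3 hboundC
    -- but `u = 0` a.e. on the slab would force `C(Q(0,1); u) = 0`
    have hzero' : ∀ᵐ z ∂(volume.restrict (parabolicCylinder 1 (0 : ℝ × EuclideanSpace ℝ (Fin 3)))),
        uncurry u z = 0 := by
      have h0 : uncurry u =ᵐ[volume.restrict (Iio (0 : ℝ) ×ˢ (univ : Set (EuclideanSpace ℝ (Fin 3))))]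
          uncurry (Nᶜ.indicator u) := ae_restrict_of_ae (hae.mono fun z hz => hz.symm)
      have h1 : uncurry u =ᵐ[volume.restrict (Iio (0 : ℝ) ×ˢ (univ : Set (EuclideanSpace ℝ (Fin 3))))] 0 :=
        h0.trans hzero
      exact ae_restrict_of_ae_restrict_of_subset (parabolicCylinder_subset_lowerHalf le_rfl 1) h1
    have hC0 : cknC 1 (0 : ℝ × EuclideanSpace ℝ (Fin 3)) u = 0 := by
      unfold cknC
      rw [lintegral_congr_ae (g := fun _ => 0) ?_, lintegral_zero, mul_zero]
      filter_upwards [hzero'] with z hz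
      have e : u z.1 z.2 = 0 := hz
      simp [e]
    rw [hC0] at hC
    exact absurd hC (not_le.2 (ENNReal.ofReal_pos.2 hε₀))

end Summit.NavierStokesRegularity.NavierStokesRegularity.Theorems.SereginZoomReduction
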